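import Literature.Probability.Percolation.ArmSeparationExtArm
import Literature.Probability.Percolation.AdjExitChains
import HarnessLib

/-!
# Extracting a landed arm from a path that can enter the free space only from below

Topic `Literature/Probability/Percolation`; family `crit-perc` / near-critical percolation on `𝕋`.
A brick of the near-critical arm-separation theorem for four arms in the ADJACENT colour
arrangement (P. Nolin, EJP 13 (2008), Thm. 11, `j = 4`, `σ = BBWW` [arXiv 0711.4948: Thm. 10]),
landing step: the two arms of one colour are continued by Menger's theorem inside a union `X` of
corridor boxes, and each output path ends on the TOP row of an outer free space
`sepOuterFence N z`; since near that free space `X` offers only the free space itself and sites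
below it, the last part of the path is a vertical crossing of the free space, and the path is an arm
landed at `z` in the sense of `extOpenArm` (`extOpenArm_of_pathIn`). Everything here is proved.

## References

* P. Nolin, Near-critical percolation in two dimensions, *Electron. J. Probab.* 13 (2008), §4.2
  Def. 6–8 and §4.4 (arXiv 0711.4948: proof of Thm. 10, p. 13) [Nolin2008].
-/

noncomputable section

open Set

namespace Literature.Probability.Percolation

open LatticeModels

/-- **A landed arm from a path entering the free space from below.** Let `z ∈ sepLanding N`,
`X ⊆ ω` a set of sites inside the arm region `{n ≤ |v| ≤ N} ∪ B(z, N/8)` such that every site of `X`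
within one step of the free space `sepOuterFence N z` lies in the free space or strictly below its
bottom row. Then an `X`-path from a site of norm `n ≤ N` to a site of the top row of the free space
makes `ω ∈ extOpenArm n N`. [cite: Nolin2008, §4.2 Def. 6–8 (arXiv 0711.4948)] -/
theorem extOpenArm_of_pathIn {n N : ℕ} (hnN : n ≤ N) {ω : SiteConfig (Site 2)} {z : Site 2} (hz : z ∈ sepLanding N)
    {X : Set (Site 2)} (hXω : X ⊆ ω) (hXreg : X ⊆ triAnnulusSet n N ∪ triOpenBall z (N / 8))
    (hXnb : ∀ v ∈ X, (N : ℤ) ≤ v 0 → v 0 ≤ (N : ℤ) + (N / 8 : ℕ) + 1 → z 1 - (N / 64 : ℕ) - 1 ≤ v 1 →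
      v 1 ≤ z 1 + (N / 64 : ℕ) + 1 → v ∈ sepOuterFence N z ∨ v 1 < z 1 - (N / 64 : ℕ))
    {a y : Site 2} (ha : triNorm a = n) (hy : y ∈ sepOuterFence N z) (hy1 : y 1 = z 1 + (N / 64 : ℕ))
    (hP : PathIn triGraph X a y) : ω ∈ extOpenArm n N := by
  -- `a` is not in the free space (its column is at most `n ≤ N`)
  have haF : a ∉ sepOuterFence N z := fun h => by
    have h1 := h.1
    have h2 := apply_zero_le_triNorm a
    have : (n : ℤ) ≤ N := by exact_mod_cast hnN
    omega
  -- walk back from `y` inside the free space down to its last site `p`, left through `q`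
  obtain ⟨p, q, hpF, hqF, hqX, hpq, hyp⟩ := hP.symm.exit (R := sepOuterFence N z) hy haF
  have hp1 : p 1 = z 1 - (N / 64 : ℕ) := by
    have hb := hpF
    simp only [sepOuterFence, Set.mem_setOf_eq] at hb
    have h0 := triGraph_adj_coord hpq 0
    have h1 := triGraph_adj_coord hpq 1
    rcases hXnb q hqX (by omega) (by omega) (by omega) (by omega) with h | h
    · exact absurd h hqF
    · omega
  refine ⟨z, p, a, hz, ha, ⟨p, y, hp1, hy1, PathIn.refl ⟨hpF, hXω (hyp.right_mem.2)⟩,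
    hyp.symm.mono fun v hv => ⟨hv.1, hXω hv.2⟩⟩, ?_⟩
  exact (hP.trans (hyp.mono fun v hv => hv.2)).mono fun v hv => ⟨hXreg hv, hXω hv⟩

end Literature.Probability.Percolation
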